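import Literature.MathematicalPhysics.KineticTheory.HardSphereEulerProofs
import HarnessLib

/-!
# Crux `NearConstantShortTimeHL` (stmt-AtomisticToContinuum-12502), line `small-tilt-domination` — stub `lintegral_exp_linear_kinetic_le`

Support file for the crux `…Theses.RelayRaceLocality.NearConstantShortTimeHL` (route
`route-AtomisticToContinuum-RelayRaceLocality`), line `small-tilt-domination`: the LINEAR kinetic term of the
conditional Gaussian (chessboard) estimate `stub_velocityLD`.

Given the positions `x : Fin m → 𝕋³`, the velocities are independent Gaussians
`velMeasure u₁ θ₁ x = ⊗ᵢ N(u₁(xᵢ), θ₁(xᵢ) I₃)`. The linear term of the domination of the fluctuation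
functional is `a ∑ᵢ wᵢ (Yᵢ)₊` with `Yᵢ = ‖vᵢ‖²/2 − ‖u₁(xᵢ)‖²/2 − 3θ₁(xᵢ)/2` and deterministic weights
`wᵢ ∈ [0, 1]`. Its exponential moment factorises over the particles (Tonelli for `Measure.pi`,
`lintegral_fin_nat_prod_eq_prod`), and each factor is bounded by the one-particle Gaussian hypothesis at
`s = a wᵢ ∈ [0, γ₀]`:

  `∫⁻ exp(a ∑ wᵢ (Yᵢ)₊) d velMeasure = ∏ᵢ ∫⁻ exp(a wᵢ (Yᵢ)₊) dN(u₁(xᵢ), θ₁(xᵢ)) ≤ ∏ᵢ exp(B a wᵢ) = exp(B a ∑ wᵢ)`.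
-/

noncomputable section

namespace Summit.AtomisticToContinuum.HydrodynamicLimit.Theorems.NearConstantShortTimeHL

open MeasureTheory ProbabilityTheory
open Literature.MathematicalPhysics.KineticTheory
open scoped ENNReal BigOperators

/-- **Linear kinetic term of the conditional Gaussian estimate.** If the one-particle Gaussian
`N(u, θ I₃)` satisfies `∫⁻ exp(s (‖v‖²/2 − ‖u‖²/2 − 3θ/2)₊) ≤ exp(B s)` for `s ∈ [0, γ₀]` uniformly over the
profile window `M⁻¹ ≤ θ ≤ M`, `‖u‖ ≤ M`, then under the product velocity law `velMeasure u₁ θ₁ x` and for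
weights `wᵢ ∈ [0, 1]`, `a ∈ [0, γ₀]`,
`∫⁻ exp(a ∑ᵢ wᵢ (Yᵢ)₊) ≤ exp(B a ∑ᵢ wᵢ)`, `Yᵢ = ‖vᵢ‖²/2 − ‖u₁(xᵢ)‖²/2 − 3θ₁(xᵢ)/2`: the integrand is the
product `∏ᵢ exp(a wᵢ (Yᵢ)₊)` of one-coordinate factors, Tonelli factorises the integral, and each factor is
the hypothesis at `s = a wᵢ`. [folklore] -/
theorem lintegral_exp_linear_kinetic_le : ∀ {M γ₀ B : ℝ}, (∀ s : ℝ, 0 ≤ s → s ≤ γ₀ → ∀ (u : V3) (θ : ℝ), M⁻¹ ≤ θ → θ ≤ M → ‖u‖ ≤ M → ∫⁻ v, ENNReal.ofReal (Real.exp (s * max 0 (‖v‖ ^ 2 / 2 - ‖u‖ ^ 2 / 2 - 3 / 2 * θ))) ∂(gaussMeasure u θ) ≤ ENNReal.ofReal (Real.exp (B * s))) → ∀ {m : ℕ} {θ₁ : T3 → ℝ} {u₁ : T3 → V3}, (∀ y, M⁻¹ ≤ θ₁ y ∧ θ₁ y ≤ M ∧ ‖u₁ y‖ ≤ M) → ∀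 (x : Fin m → T3) (w : Fin m → ℝ), (∀ i, 0 ≤ w i ∧ w i ≤ 1) → ∀ {a : ℝ}, 0 ≤ a → a ≤ γ₀ → ∫⁻ v, ENNReal.ofReal (Real.exp (a * ∑ i, w i * max 0 (‖v i‖ ^ 2 / 2 - ‖u₁ (x i)‖ ^ 2 / 2 - 3 / 2 * θ₁ (x i)))) ∂(velMeasure u₁ θ₁ x) ≤ ENNReal.ofReal (Real.exp (B * a * ∑ i, w i)) := by
  intro M γ₀ B hone m θ₁ u₁ hprof x w hw a ha0 haγ
  -- the one-coordinate factors of the integrand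
  set F : Fin m → V3 → ℝ≥0∞ := fun i z =>
    ENNReal.ofReal (Real.exp (a * w i * max 0 (‖z‖ ^ 2 / 2 - ‖u₁ (x i)‖ ^ 2 / 2 - 3 / 2 * θ₁ (x i))))
    with hF
  have hFm : ∀ i, Measurable (F i) := fun i => by
    have hc : Continuous (F i) := by
      simp only [hF]
      exact ENNReal.continuous_ofReal.comp (by fun_prop)
    exact hc.measurable
  -- the block marginals
  set μ : Fin m → Measure V3 := fun i => gaussMeasure (u₁ (x i)) (θ₁ (x i)) with hμ
  calc ∫⁻ v, ENNReal.ofReal (Real.exp (a * ∑ i, w i *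
          max 0 (‖v i‖ ^ 2 / 2 - ‖u₁ (x i)‖ ^ 2 / 2 - 3 / 2 * θ₁ (x i)))) ∂(velMeasure u₁ θ₁ x)
      = ∫⁻ v, ∏ i, F i (v i) ∂(Measure.pi μ) := by
        refine lintegral_congr fun v => ?_
        rw [Finset.mul_sum, Real.exp_sum,
          ENNReal.ofReal_prod_of_nonneg fun i _ => (Real.exp_pos _).le]
        refine Finset.prod_congr rfl fun i _ => ?_
        rw [hF, ← mul_assoc]
    _ = ∏ i, ∫⁻ z, F i z ∂(μ i) := lintegral_fin_nat_prod_eq_prod μ hFm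
    _ ≤ ∏ i, ENNReal.ofReal (Real.exp (B * (a * w i))) := by
        refine Finset.prod_le_prod' fun i _ => ?_
        have hs0 : 0 ≤ a * w i := mul_nonneg ha0 (hw i).1
        have hsγ : a * w i ≤ γ₀ := (mul_le_of_le_one_right ha0 (hw i).2).trans haγ
        exact hone (a * w i) hs0 hsγ (u₁ (x i)) (θ₁ (x i)) (hprof _).1 (hprof _).2.1 (hprof _).2.2
    _ = ENNReal.ofReal (Real.exp (B * a * ∑ i, w i)) := by
        rw [mul_assoc, Finset.mul_sum, Finset.mul_sum, Real.exp_sum,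
          ENNReal.ofReal_prod_of_nonneg fun i _ => (Real.exp_pos _).le]

end Summit.AtomisticToContinuum.HydrodynamicLimit.Theorems.NearConstantShortTimeHL
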